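import Literature.AnabelianGeometry.EtaleTheta.Discharge.Sec2RigidRowsAtModelTateInr
import Literature.AnabelianGeometry.EtaleTheta.Discharge.Sec2Cor218iAtModelTateOfExtends
import HarnessLib

/-!
# [EtTh] §2 tower / rigidity rows AT THE TATE DATUM OF RECORD with the Cor. 2.18 (i) binder `h218i`
# REPLACED by abc-iut-L6-d6's reduction `⟸ {hextΔ, hgal}` (proof-only capstone; FROZEN FACT-LIST rows
# F-0647, F-0649, F-0625, F-0639 — and F-0620 at every chain level — for the datum `etaleThetaDataχqInr p`)

S. Mochizuki, *The étale theta function and its Frobenioid-theoretic manifestations*, Publ. RIMS **45** (2009)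
[EtTh], §2: Cor. 2.18 (i) p. 60, Cor. 2.18 (iv) pp. 61–62, Cor. 2.19 (ii) p. 64, Cor. 2.16 p. 53 (locators
`p.N` = PDF pages of the PRIMS text) [cite: MochizukiEtTh2009, Cor 2.18 (iv) p.61]. Cell `abc-iut`, block F,
seat abc-iut-f-153 (gen 6; F-TRANCHES tranche 153, trunk `ThetaSystems.lean`; rows of record of this lineage at
the Tate datum: abc-iut-f-153 gen 5's `Sec2Cor216Cor218ivOddAtModelTate` p453594/p454435 and
`Sec2RigidRowsAtModelTateInr` p456036/p457392). PROOF-ONLY: no definition, no instance, no notation, no new named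
fact; every input consumed BY NAME, nothing of another seat restated.

STATE OF RECORD BEFORE THIS FILE. At the Tate instance `ThetaSetting.modelχq p 1 2` and the étale-theta datum of
record `etaleThetaDataχqInr p` (abc-iut-w5-d171), the rows F-0647 (Cor. 2.18 (iv) odd bijectivity), F-0649
(Cor. 2.19 (ii)), F-0625 / F-0639 (Cor. 2.18 (iv) surjectivity, `RigidData` / `ThetaEnvData` currency) hold
MODULO EXACTLY the two §2 rigidity binders `h218i` (Cor. 2.18 (i) for the rigidity data at the chain levels, at a
cusp labelling `L`) and `h219iii` (`ThetaEnvTower.Cor219_iii`) — gen 5's `…_of_rigidity` theorems. abc-iut-L6-d6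
(row «COR218I-AT-MODELTATE», `Discharge/Sec2Cor218iAtModelTateOfExtends`, p468072) then proved Cor. 2.18 (i) for
`C.rigidData μ hC hS h15 L∅` at `modelχq p i 2` (every `i`, every étale-theta datum, every `X̲̲`-choice, every level,
the EMPTY cusp labelling `L∅`) FROM the two label-free hypotheses
  `hextΔ` : every bi-continuous automorphism `γ` of `Π^tp_X̲̲` extends to a bi-continuous automorphism `Γ` of
            `Π^tp_X` with `Γ(Δ^tp_X) = Δ^tp_X` ([EtTh] Prop. 2.4 (i) / [Mzk3] Thm. 2.4 shape), and
  `hgal`  : every such `γ` lies over an INNER automorphism of `G_{ℚ_p}`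
(`SettingModel.rigidData_cor218_i_modelχq_of_extends_of_hgal`).

WHAT THIS FILE DOES (one-term compositions, `i := 1`, `L := L∅`):
* `cor218_i_levels_emptyLabels_modelTate_inr_of_extends_of_hgal` — the binder `h218i` of the rows of record, at
  EVERY chain level of every cyclotome tower `τ`, IS abc-iut-L6-d6's theorem: F-0620 at the datum of record
  ⟸ {hextΔ, hgal};
* `cor218_iv_bijective_of_odd_modelTate_inr_of_extends_of_hgal` (F-0647),
  `cor219_ii_modelTate_inr_of_extends_of_hgal` (F-0649),
  `rigidData_cor218_iv_surjective_modAll_modelTate_inr_of_extends_of_hgal` (F-0625, every level `M ∈ ℕ≥1`),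
  `thetaEnvData_cor218_iv_surjective_modAll_modelTate_inr_of_extends_of_hgal` (F-0639, idem) — the rows of
  record with `h218i` REPLACED: binders = data `C`, `τ` and the Props `hextΔ`, `hgal`, `h219iii`;
* `sec2_tower_rows_modelTate_inr_of_extends_of_hgal` — census conjunction Cor. 2.16 ∧ Cor. 2.18 (iv)
  [reduction ∧ odd bijectivity] ∧ Cor. 2.19 (ii) at the datum of record ⟸ {hextΔ, hgal, h219iii}.

RESIDUAL-OF-RECORD after this file: {hextΔ, hgal, h219iii} (all label-free; `h219iii`'s inner half is a
theorem at every §1 setting, abc-iut-w4-d038 `cor219_iii_conclusion_of_inner` p467752; its reduction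
«`h219iii` ⟸ hextΔ ∧ hgal» is abc-iut-w4-d038's row «COR219III-AT-MODELTATE» part 2, pending — when it lands, one
more one-term composition gives the rows ⟸ {hextΔ, hgal}). The ABSOLUTE forms (no hypothesis on
`Aut_top(Π^tp_X̲̲)`) are statements about the automorphism group of `dUU_l ⋊ G_{ℚ_p}` which no tree / Mathlib fact
decides (abc-iut-f-153 gen 6 census, STATUS 2026-08-26 19:1xZ / 21:1xZ).

HONEST LABEL: `modelχq` is a SEMI-SYNTHETIC model of the typed §1 interface — binder-discharge / consistency
evidence for OUR typed rows only; nothing of [EtTh] (refereed) is asserted; a FACT row is an assumption label, not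
an endorsement; no side is taken on [IUTchIII] Cor. 3.12; typed ≠ proved.
-/

noncomputable section

namespace Literature.AnabelianGeometry.EtaleTheta.SettingModel

open Literature.AnabelianGeometry.SemiGraphs

variable (p : ℕ) [Fact p.Prime]
variable {l : ℕ} (C : (etaleThetaDataχqInr p).DoubleUnderline l) {Es : Set ℕ+}
  (τ : (ThetaSetting.modelχq p 1 2 even_two).CyclotomeTower l Es)

/-! ## §1. The binder `h218i` at the datum of record IS abc-iut-L6-d6's theorem (F-0620 ⟸ {hextΔ, hgal}) -/

/-- **F-0620 [EtTh] Cor. 2.18 (i) at EVERY chain level of the model tower of the datum OF RECORD, at the empty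
cusp labelling, FROM `hextΔ` and `hgal`** — abc-iut-L6-d6's `rigidData_cor218_i_modelχq_of_extends_of_hgal` at
`i := 1`, `μ := τ.mod M`, `h15 :=` abc-iut-w5-d171's `prop15iii_etaleThetaDataχqInr`. This is literally the binder
`h218i` of the `…_of_rigidity` rows of record (at `L := L∅`). [cite: MochizukiEtTh2009, Cor 2.18 (i) p.60] -/
theorem cor218_i_levels_emptyLabels_modelTate_inr_of_extends_of_hgal
    (hext : ∀ γ : ↥C.Huu ≃ₜ* ↥C.Huu, ∃ Γ : PiTpχq p 1 2 ≃ₜ* PiTpχq p 1 2,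
      (∀ h : C.Huu, Γ (h : PiTpχq p 1 2) = ((γ h : C.Huu) : PiTpχq p 1 2)) ∧
        (curveχq p 1 2).DeltaTemp.map Γ.toMulEquiv.toMonoidHom = (curveχq p 1 2).DeltaTemp)
    (hgal : ∀ γ : ↥C.Huu ≃ₜ* ↥C.Huu, ∃ t : GQp p, ∀ h : C.Huu,
      (((γ h : C.Huu) : PiTpχq p 1 2)).right = t * (h : PiTpχq p 1 2).right * t⁻¹)
    (M : Es) :
    (C.rigidData (τ.mod M) (compat_modelχq p 1 2 even_two) (ThetaSetting.modelχq_sec2Hyps p 1 2 even_two)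
      (prop15iii_etaleThetaDataχqInr p _) ⟨fun _ => ∅, fun _ => ∅, fun _ => rfl⟩).Cor218_i :=
  rigidData_cor218_i_modelχq_of_extends_of_hgal p 1 C (τ.mod M) _ _ _ hext hgal

/-- The same at the levels `τ.modAll M`, `M ∈ ℕ≥1` (the level data used by the `modAll` surjectivity rows).
[cite: MochizukiEtTh2009, Cor 2.18 (i) p.60] -/
theorem cor218_i_modAll_emptyLabels_modelTate_inr_of_extends_of_hgal
    (hext : ∀ γ : ↥C.Huu ≃ₜ* ↥C.Huu, ∃ Γ : PiTpχq p 1 2 ≃ₜ* PiTpχq p 1 2,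
      (∀ h : C.Huu, Γ (h : PiTpχq p 1 2) = ((γ h : C.Huu) : PiTpχq p 1 2)) ∧
        (curveχq p 1 2).DeltaTemp.map Γ.toMulEquiv.toMonoidHom = (curveχq p 1 2).DeltaTemp)
    (hgal : ∀ γ : ↥C.Huu ≃ₜ* ↥C.Huu, ∃ t : GQp p, ∀ h : C.Huu,
      (((γ h : C.Huu) : PiTpχq p 1 2)).right = t * (h : PiTpχq p 1 2).right * t⁻¹)
    (M : ℕ+) :
    (C.rigidData (τ.modAll M) (compat_modelχq p 1 2 even_two) (ThetaSetting.modelχq_sec2Hyps p 1 2 even_two)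
      (prop15iii_etaleThetaDataχqInr p _) ⟨fun _ => ∅, fun _ => ∅, fun _ => rfl⟩).Cor218_i :=
  rigidData_cor218_i_modelχq_of_extends_of_hgal p 1 C (τ.modAll M) _ _ _ hext hgal

/-! ## §2. The rows of record with `h218i` replaced by {hextΔ, hgal} -/

/-- **F-0647 [EtTh] Cor. 2.18 (iv) «[hence is a bijection if `N/M` is odd]» for the model tower of the datum OF
RECORD, modulo {hextΔ, hgal, `ThetaEnvTower.Cor219_iii`}** (gen 5's `cor218_iv_bijective_of_odd_modelTate_inr_of_rigidity`
at `L∅` with `h218i :=` §1). [cite: MochizukiEtTh2009, Cor 2.18 (iv) p.62] -/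
theorem cor218_iv_bijective_of_odd_modelTate_inr_of_extends_of_hgal
    (hext : ∀ γ : ↥C.Huu ≃ₜ* ↥C.Huu, ∃ Γ : PiTpχq p 1 2 ≃ₜ* PiTpχq p 1 2,
      (∀ h : C.Huu, Γ (h : PiTpχq p 1 2) = ((γ h : C.Huu) : PiTpχq p 1 2)) ∧
        (curveχq p 1 2).DeltaTemp.map Γ.toMulEquiv.toMonoidHom = (curveχq p 1 2).DeltaTemp)
    (hgal : ∀ γ : ↥C.Huu ≃ₜ* ↥C.Huu, ∃ t : GQp p, ∀ h : C.Huu,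
      (((γ h : C.Huu) : PiTpχq p 1 2)).right = t * (h : PiTpχq p 1 2).right * t⁻¹)
    (h219iii : (C.thetaEnvTower τ (compat_modelχq p 1 2 even_two)
      (ThetaSetting.modelχq_sec2Hyps p 1 2 even_two)).Cor219_iii) :
    (C.thetaEnvTower τ (compat_modelχq p 1 2 even_two)
      (ThetaSetting.modelχq_sec2Hyps p 1 2 even_two)).Cor218_iv_bijective_of_odd :=
  cor218_iv_bijective_of_odd_modelTate_inr_of_rigidity p C τ _
    (cor218_i_levels_emptyLabels_modelTate_inr_of_extends_of_hgal p C τ hext hgal) h219iii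

/-- **F-0649 [EtTh] Cor. 2.19 (ii) (Discrete Rigidity) for the model tower of the datum OF RECORD, modulo
{hextΔ, hgal, `ThetaEnvTower.Cor219_iii`}** (gen 5's `cor219_ii_modelTate_inr_of_rigidity` at `L∅` with `h218i :=` §1).
[cite: MochizukiEtTh2009, Cor 2.19 (ii) p.64] -/
theorem cor219_ii_modelTate_inr_of_extends_of_hgal
    (hext : ∀ γ : ↥C.Huu ≃ₜ* ↥C.Huu, ∃ Γ : PiTpχq p 1 2 ≃ₜ* PiTpχq p 1 2,
      (∀ h : C.Huu, Γ (h : PiTpχq p 1 2) = ((γ h : C.Huu) : PiTpχq p 1 2)) ∧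
        (curveχq p 1 2).DeltaTemp.map Γ.toMulEquiv.toMonoidHom = (curveχq p 1 2).DeltaTemp)
    (hgal : ∀ γ : ↥C.Huu ≃ₜ* ↥C.Huu, ∃ t : GQp p, ∀ h : C.Huu,
      (((γ h : C.Huu) : PiTpχq p 1 2)).right = t * (h : PiTpχq p 1 2).right * t⁻¹)
    (h219iii : (C.thetaEnvTower τ (compat_modelχq p 1 2 even_two)
      (ThetaSetting.modelχq_sec2Hyps p 1 2 even_two)).Cor219_iii) :
    (C.thetaEnvTower τ (compat_modelχq p 1 2 even_two)
      (ThetaSetting.modelχq_sec2Hyps p 1 2 even_two)).Cor219_ii :=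
  cor219_ii_modelTate_inr_of_rigidity p C τ _
    (cor218_i_levels_emptyLabels_modelTate_inr_of_extends_of_hgal p C τ hext hgal) h219iii

/-- **F-0625 [EtTh] Cor. 2.18 (iv), surjectivity, for the rigidity data of the datum OF RECORD at EVERY level
`M ∈ ℕ≥1` (empty cusp labelling), modulo {hextΔ, hgal, `ThetaEnvTower.Cor219_iii`}** (gen 5's
`rigidData_cor218_iv_surjective_modAll_modelTate_inr_of_rigidity` with `h218i :=` §1).
[cite: MochizukiEtTh2009, Cor 2.18 (iv) p.61] -/
theorem rigidData_cor218_iv_surjective_modAll_modelTate_inr_of_extends_of_hgal (M : ℕ+)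
    (hext : ∀ γ : ↥C.Huu ≃ₜ* ↥C.Huu, ∃ Γ : PiTpχq p 1 2 ≃ₜ* PiTpχq p 1 2,
      (∀ h : C.Huu, Γ (h : PiTpχq p 1 2) = ((γ h : C.Huu) : PiTpχq p 1 2)) ∧
        (curveχq p 1 2).DeltaTemp.map Γ.toMulEquiv.toMonoidHom = (curveχq p 1 2).DeltaTemp)
    (hgal : ∀ γ : ↥C.Huu ≃ₜ* ↥C.Huu, ∃ t : GQp p, ∀ h : C.Huu,
      (((γ h : C.Huu) : PiTpχq p 1 2)).right = t * (h : PiTpχq p 1 2).right * t⁻¹)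
    (h219iii : (C.thetaEnvTower τ (compat_modelχq p 1 2 even_two)
      (ThetaSetting.modelχq_sec2Hyps p 1 2 even_two)).Cor219_iii) :
    (C.rigidData (τ.modAll M) (compat_modelχq p 1 2 even_two) (ThetaSetting.modelχq_sec2Hyps p 1 2 even_two)
      (prop15iii_etaleThetaDataχqInr p _) ⟨fun _ => ∅, fun _ => ∅, fun _ => rfl⟩).Cor218_iv_surjective :=
  rigidData_cor218_iv_surjective_modAll_modelTate_inr_of_rigidity p C τ M _
    (cor218_i_levels_emptyLabels_modelTate_inr_of_extends_of_hgal p C τ hext hgal) h219iii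

/-- **F-0639 the same in `ThetaEnvData` currency** (`Cor218_iv_surjective` of the level-`M` mono-theta environment of
the datum of record = the input `hsurj` of the [IUTchII] Prop. 1.5 model bridges of layer L6), modulo
{hextΔ, hgal, `ThetaEnvTower.Cor219_iii`}. [cite: MochizukiEtTh2009, Cor 2.18 (iv) p.61] -/
theorem thetaEnvData_cor218_iv_surjective_modAll_modelTate_inr_of_extends_of_hgal (M : ℕ+)
    (hext : ∀ γ : ↥C.Huu ≃ₜ* ↥C.Huu, ∃ Γ : PiTpχq p 1 2 ≃ₜ* PiTpχq p 1 2,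
      (∀ h : C.Huu, Γ (h : PiTpχq p 1 2) = ((γ h : C.Huu) : PiTpχq p 1 2)) ∧
        (curveχq p 1 2).DeltaTemp.map Γ.toMulEquiv.toMonoidHom = (curveχq p 1 2).DeltaTemp)
    (hgal : ∀ γ : ↥C.Huu ≃ₜ* ↥C.Huu, ∃ t : GQp p, ∀ h : C.Huu,
      (((γ h : C.Huu) : PiTpχq p 1 2)).right = t * (h : PiTpχq p 1 2).right * t⁻¹)
    (h219iii : (C.thetaEnvTower τ (compat_modelχq p 1 2 even_two)
      (ThetaSetting.modelχq_sec2Hyps p 1 2 even_two)).Cor219_iii) :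
    (C.thetaEnvData (τ.modAll M) (compat_modelχq p 1 2 even_two)
      (ThetaSetting.modelχq_sec2Hyps p 1 2 even_two)).Cor218_iv_surjective :=
  thetaEnvData_cor218_iv_surjective_modAll_modelTate_inr_of_rigidity p C τ M _
    (cor218_i_levels_emptyLabels_modelTate_inr_of_extends_of_hgal p C τ hext hgal) h219iii

/-! ## §3. Census conjunction at the datum of record -/

/-- **THE §2 TOWER ROWS AT THE DATUM OF RECORD, modulo {hextΔ, hgal, `ThetaEnvTower.Cor219_iii`}** (Tate
instance `modelχq p 1 2`, étale-theta datum `etaleThetaDataχqInr p`, every `X̲̲`-choice `C`, every cyclotome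
tower `τ`; empty cusp labelling): Cor. 2.16 (F-0646) ∧ Cor. 2.18 (iv) reduction (F-0648) ∧ Cor. 2.18 (iv) odd
bijectivity (F-0647) ∧ Cor. 2.19 (ii) (F-0649) — gen 5's `sec2_tower_rows_modelTate_inr_of_rigidity` with the
Cor. 2.18 (i) binder discharged by abc-iut-L6-d6's reduction. [cite: MochizukiEtTh2009, Cor 2.19 (ii) p.64] -/
theorem sec2_tower_rows_modelTate_inr_of_extends_of_hgal
    (hext : ∀ γ : ↥C.Huu ≃ₜ* ↥C.Huu, ∃ Γ : PiTpχq p 1 2 ≃ₜ* PiTpχq p 1 2,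
      (∀ h : C.Huu, Γ (h : PiTpχq p 1 2) = ((γ h : C.Huu) : PiTpχq p 1 2)) ∧
        (curveχq p 1 2).DeltaTemp.map Γ.toMulEquiv.toMonoidHom = (curveχq p 1 2).DeltaTemp)
    (hgal : ∀ γ : ↥C.Huu ≃ₜ* ↥C.Huu, ∃ t : GQp p, ∀ h : C.Huu,
      (((γ h : C.Huu) : PiTpχq p 1 2)).right = t * (h : PiTpχq p 1 2).right * t⁻¹)
    (h219iii : (C.thetaEnvTower τ (compat_modelχq p 1 2 even_two)
      (ThetaSetting.modelχq_sec2Hyps p 1 2 even_two)).Cor219_iii) :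
    (C.thetaEnvTower τ (compat_modelχq p 1 2 even_two) (ThetaSetting.modelχq_sec2Hyps p 1 2 even_two)).Cor216 ∧
    (C.thetaEnvTower τ (compat_modelχq p 1 2 even_two)
      (ThetaSetting.modelχq_sec2Hyps p 1 2 even_two)).Cor218_iv_reduction ∧
    (C.thetaEnvTower τ (compat_modelχq p 1 2 even_two)
      (ThetaSetting.modelχq_sec2Hyps p 1 2 even_two)).Cor218_iv_bijective_of_odd ∧
    (C.thetaEnvTower τ (compat_modelχq p 1 2 even_two)
      (ThetaSetting.modelχq_sec2Hyps p 1 2 even_two)).Cor219_ii :=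
  sec2_tower_rows_modelTate_inr_of_rigidity p C τ _
    (cor218_i_levels_emptyLabels_modelTate_inr_of_extends_of_hgal p C τ hext hgal) h219iii

end Literature.AnabelianGeometry.EtaleTheta.SettingModel

end
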